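import Summits.RiemannHypothesis.RiemannHypothesis.Theorems.TiltedLandingLaw421R3SinkTemplate

/-!
# TiltedLandingLaw421R3 — «LimitDichotomy» (W-08 C1 scratch, rh-idea-5 g41): the TWO-VARIABLE POLYNOMIAL
DICHOTOMY behind the datum side of the E5 limit menu law (C3 rh-idea-3 g58 RESULT-8), TYPED, with the tail PROVED

C3 RESULT-8 (exact-rational interval certificate `g58/eng/limit2var.py` f43763e2, 317 boxes; NOT a kernel fact):
with `κ = 27/256`, `Q = δ²/(Y² − t²) ∈ [0,1)`, `r = (Y + t)/(Y − t) > 1`, `W = r² + 1 + 2Qr`,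
the leading-order A-sector margin is `κ‖K‖² − Φ⁰ = E²/(r(A₁A₂)²) · A(Q,r)` with
`A(Q,r) = κQW² + κr(r − 1)²(1 − Q)² − 2Q(1 − Q)rW`, and the leading-order top half-plane read holds whenever
`T(Q,r) = 64(1 − Q) − min(8/(r + 1), 1/2)·(Qr + 1)(Q + r) > 0`.  The datum side of E5 is then the statement
`LimitDichotomySig : ∀ Q ∈ [0,1], ∀ r ≥ 1, A(Q,r) ≥ 0 ∨ T(Q,r) > 0` — typed below as an OPEN `def … : Prop`
(asserted by nothing; the certificate is numerical-exact, not Lean).  PROVED here: the TAIL `r ≥ 512/27 ⇒ A ≥ 0`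
(C3's one line: `A ≥ QrW(κr − 2(1 − Q)) ≥ 0` using `W ≥ r²`), and the two EDGES `Q = 0 ⇒ A ≥ 0`, `Q = 1 ⇒ A ≥ 0`,
so the open part is the compact box `Q ∈ (0,1), r ∈ [1, 512/27]` (317 rational boxes in C3's run, or a hand SOS).
v2 (22:30Z): `LimitDichotomySig` is now PROVED OUTRIGHT (★`limitDichotomySig_holds`), no boxes — proof = C3 rh-idea-3 g58
RESULT-10 scratch `LimitDichotomy-SCRATCH-v2-W09-C3-rh-idea-3-g58.lean` c6239d28 (band split `κW < 2(1 − Q)r`: outside the band the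
A-disjunct by the factor bound; inside the band `r < 19` and the T-disjunct by two `nlinarith` certificates, `min ≤ 1/2` for `r ≤ 15`,
`min ≤ 8/(r+1)` for `15 ≤ r`), re-homed here verbatim modulo names onto this file's definitions (one writer per namespace).
Pure real algebra; no `f`, no law about entire functions. Sorry-free.
-/

namespace RhW08.LimitMenu

/-- The thin-strip constant of record `κ = 27/256` ((CA1155): thincert j344858 ran at kappa = 27/256, λ² = 5/4). -/
noncomputable def kap : ℝ := 27 / 256

/-- `W(Q,r) = r² + 1 + 2Qr`. -/
noncomputable def limW (Q r : ℝ) : ℝ := r ^ 2 + 1 + 2 * Q * r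

/-- The A-sector margin polynomial `A(Q,r) = κQW² + κr(r − 1)²(1 − Q)² − 2Q(1 − Q)rW`. -/
noncomputable def limA (Q r : ℝ) : ℝ :=
  kap * Q * limW Q r ^ 2 + kap * r * (r - 1) ^ 2 * (1 - Q) ^ 2 - 2 * Q * (1 - Q) * r * limW Q r

/-- The top-half-plane margin `T(Q,r) = 64(1 − Q) − min(8/(r + 1), 1/2)·(Qr + 1)(Q + r)`. -/
noncomputable def limT (Q r : ℝ) : ℝ := 64 * (1 - Q) - min (8 / (r + 1)) (1 / 2) * (Q * r + 1) * (Q + r)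

/-- The DATUM-SIDE LIMIT DICHOTOMY: every `(Q,r)` with `0 ≤ Q ≤ 1 ≤ r` has `A ≥ 0` or `T > 0`
(C3 RESULT-8's exact-rational certificate; PROVED below as `limitDichotomySig_holds`, C3 RESULT-10's band-split proof). -/
def LimitDichotomySig : Prop := ∀ Q r : ℝ, 0 ≤ Q → Q ≤ 1 → 1 ≤ r → 0 ≤ limA Q r ∨ 0 < limT Q r

/-- `W ≥ r²` for `Q, r ≥ 0`. -/
theorem sq_le_limW (Q r : ℝ) (hQ : 0 ≤ Q) (hr : 0 ≤ r) : r ^ 2 ≤ limW Q r := by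
  unfold limW; nlinarith [mul_nonneg hQ hr]

/-- `W > 0` for `Q, r ≥ 0`. -/
theorem limW_pos (Q r : ℝ) (hQ : 0 ≤ Q) (hr : 0 ≤ r) : 0 < limW Q r := by
  unfold limW; nlinarith [mul_nonneg hQ hr, sq_nonneg r]

/-- FACTORED LOWER BOUND (dropping the middle square):
`A ≥ Q·W·(κ·W − 2(1 − Q)·r)` for every real `Q` and `r ≥ 0` (the dropped term `κr(r − 1)²(1 − Q)²` is ≥ 0). -/
theorem limA_ge_factor (Q r : ℝ) (hr : 0 ≤ r) :
    Q * limW Q r * (kap * limW Q r - 2 * (1 - Q) * r) ≤ limA Q r := by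
  unfold limA
  have h2 : 0 ≤ kap * r * (r - 1) ^ 2 * (1 - Q) ^ 2 := by unfold kap; positivity
  nlinarith [h2]

/-- THE TAIL (C3 RESULT-8 (3), one line): `r ≥ 2/κ = 512/27 ⇒ A(Q,r) ≥ 0` for every `Q ≥ 0` (no upper bound on `Q` needed). -/
theorem limA_nonneg_of_tail (Q r : ℝ) (hQ : 0 ≤ Q) (hr : 512 / 27 ≤ r) : 0 ≤ limA Q r := by
  have hr0 : 0 ≤ r := by linarith
  have hW := sq_le_limW Q r hQ hr0
  have hW0 : 0 ≤ limW Q r := (limW_pos Q r hQ hr0).le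
  have hk : 2 * (1 - Q) * r ≤ kap * limW Q r := by
    have h1 : 2 * r ≤ kap * r ^ 2 := by unfold kap; nlinarith
    have h3 : 2 * (1 - Q) * r ≤ 2 * r := by nlinarith
    have h4 : kap * r ^ 2 ≤ kap * limW Q r := by unfold kap at *; nlinarith
    linarith
  have hfac := limA_ge_factor Q r hr0
  have : 0 ≤ Q * limW Q r * (kap * limW Q r - 2 * (1 - Q) * r) :=
    mul_nonneg (mul_nonneg hQ hW0) (by linarith)
  linarith

/-- EDGE `Q = 0`: `A(0,r) = κ·r·(r − 1)² ≥ 0` for `r ≥ 0`. -/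
theorem limA_nonneg_of_Q_zero (r : ℝ) (hr : 0 ≤ r) : 0 ≤ limA 0 r := by
  unfold limA kap; nlinarith [sq_nonneg (r - 1), mul_nonneg hr (sq_nonneg (r - 1))]

/-- EDGE `Q = 1`: `A(1,r) = κ·W² ≥ 0`. -/
theorem limA_nonneg_of_Q_one (r : ℝ) : 0 ≤ limA 1 r := by
  unfold limA kap; nlinarith [sq_nonneg (limW 1 r)]

/-- EDGE `r = 1`, where `A` can be NEGATIVE (`A(Q,1) = 4Q(1+Q)((κ − 1) + (κ + 1)Q) < 0` for small `Q > 0`):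
the OTHER disjunct carries it — `T(Q,1) = 64(1 − Q) − (1 + Q)²/2 > 0` for `Q ≤ 15/16`. -/
theorem limT_pos_of_r_one (Q : ℝ) (hQ : 0 ≤ Q) (hQ1 : Q ≤ 15 / 16) : 0 < limT Q 1 := by
  unfold limT
  have hmin : min (8 / ((1 : ℝ) + 1)) (1 / 2) = 1 / 2 := by norm_num
  rw [hmin]
  nlinarith

/-- REDUCTION OF THE OPEN PART to the compact box: given the dichotomy on `Q ∈ [0,1]`, `r ∈ [1, 512/27]`,
the tail lemma yields `LimitDichotomySig`. -/
theorem limitDichotomySig_of_box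
    (hbox : ∀ Q r : ℝ, 0 ≤ Q → Q ≤ 1 → 1 ≤ r → r ≤ 512 / 27 → 0 ≤ limA Q r ∨ 0 < limT Q r) :
    LimitDichotomySig := by
  intro Q r hQ hQ1 hr
  rcases le_or_gt r (512 / 27) with h | h
  · exact hbox Q r hQ hQ1 hr h
  · exact Or.inl (limA_nonneg_of_tail Q r hQ h.le)

section Proof

/-! ### The band-split proof (C3 rh-idea-3 g58 RESULT-10, re-homed) -/

/-- Inside the band `κW < 2(1−Q)r`, `r ≤ 15` ⇒ `(Qr+1)(Q+r) < 128(1−Q)` (nlinarith certificate, C3). -/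
theorem limBand_low (Q r : ℝ) (hQ0 : 0 ≤ Q) (hQ1 : Q ≤ 1) (hr : 1 ≤ r) (hr15 : r ≤ 15)
    (hband : (27 / 256 : ℝ) * (r ^ 2 + 1 + 2 * Q * r) < 2 * (1 - Q) * r) :
    (Q * r + 1) * (Q + r) < 128 * (1 - Q) := by
  nlinarith [mul_nonneg hQ0 (by linarith : (0:ℝ) ≤ r), sq_nonneg r, sq_nonneg Q,
    mul_nonneg hQ0 hQ0, mul_nonneg (sub_nonneg.mpr hQ1) (by linarith : (0:ℝ) ≤ r - 1),
    mul_nonneg (sub_nonneg.mpr hQ1) hQ0, mul_nonneg (mul_nonneg hQ0 hQ0) (by linarith : (0:ℝ) ≤ r),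
    mul_nonneg (by linarith : (0:ℝ) ≤ 15 - r) hQ0, mul_nonneg (by linarith : (0:ℝ) ≤ 15 - r) (mul_nonneg hQ0 hQ0)]

/-- Inside the band, `15 ≤ r` ⇒ `(Qr+1)(Q+r) < 8(1−Q)(r+1)`; the band forces `r < 19` (nlinarith certificate, C3). -/
theorem limBand_high (Q r : ℝ) (hQ0 : 0 ≤ Q) (hQ1 : Q ≤ 1) (hr15 : 15 ≤ r)
    (hband : (27 / 256 : ℝ) * (r ^ 2 + 1 + 2 * Q * r) < 2 * (1 - Q) * r) :
    (Q * r + 1) * (Q + r) < 8 * (1 - Q) * (r + 1) := by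
  have hr19 : r < 19 := by nlinarith [mul_nonneg hQ0 (by linarith : (0:ℝ) ≤ r), sq_nonneg r]
  nlinarith [mul_nonneg hQ0 (by linarith : (0:ℝ) ≤ r), sq_nonneg r, sq_nonneg Q,
    mul_nonneg hQ0 hQ0, mul_nonneg (sub_nonneg.mpr hQ1) hQ0, mul_nonneg (mul_nonneg hQ0 hQ0) (by linarith : (0:ℝ) ≤ r),
    mul_nonneg (by linarith : (0:ℝ) ≤ r - 15) hQ0, mul_nonneg (by linarith : (0:ℝ) ≤ 19 - r) hQ0,
    mul_nonneg (by linarith : (0:ℝ) ≤ r - 15) (mul_nonneg hQ0 hQ0)]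

/-- OUTSIDE the band the A-disjunct holds: `2(1−Q)r ≤ κW ⇒ 0 ≤ A` (by `limA_ge_factor`). -/
theorem limA_nonneg_of_not_band (Q r : ℝ) (hQ0 : 0 ≤ Q) (hr : 1 ≤ r)
    (hnb : 2 * (1 - Q) * r ≤ (27 / 256 : ℝ) * (r ^ 2 + 1 + 2 * Q * r)) : 0 ≤ limA Q r := by
  have hr0 : (0:ℝ) ≤ r := by linarith
  have hW0 : 0 ≤ limW Q r := (limW_pos Q r hQ0 hr0).le
  have hk : 2 * (1 - Q) * r ≤ kap * limW Q r := by unfold kap limW; exact hnb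
  have hfac := limA_ge_factor Q r hr0
  have : 0 ≤ Q * limW Q r * (kap * limW Q r - 2 * (1 - Q) * r) :=
    mul_nonneg (mul_nonneg hQ0 hW0) (by linarith)
  linarith

/-- INSIDE the band the T-disjunct holds. -/
theorem limT_pos_of_band (Q r : ℝ) (hQ0 : 0 ≤ Q) (hQ1 : Q ≤ 1) (hr : 1 ≤ r)
    (hband : (27 / 256 : ℝ) * (r ^ 2 + 1 + 2 * Q * r) < 2 * (1 - Q) * r) : 0 < limT Q r := by
  unfold limT
  have hX : 0 ≤ (Q * r + 1) * (Q + r) := by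
    have : 0 ≤ Q * r := mul_nonneg hQ0 (by linarith)
    positivity
  by_cases hr15 : r ≤ 15
  · have hm : min (8 / (r + 1)) (1 / 2 : ℝ) ≤ 1 / 2 := min_le_right _ _
    have hlow := limBand_low Q r hQ0 hQ1 hr hr15 hband
    have : min (8 / (r + 1)) (1 / 2 : ℝ) * (Q * r + 1) * (Q + r) ≤ (1 / 2) * ((Q * r + 1) * (Q + r)) := by
      rw [mul_assoc]; exact mul_le_mul_of_nonneg_right hm hX
    linarith
  · have hr15' : 15 ≤ r := le_of_lt (not_le.mp hr15)
    have hrp : 0 < r + 1 := by linarith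
    have hm : min (8 / (r + 1)) (1 / 2 : ℝ) ≤ 8 / (r + 1) := min_le_left _ _
    have hhigh := limBand_high Q r hQ0 hQ1 hr15' hband
    have h8 : 8 / (r + 1) * ((Q * r + 1) * (Q + r)) < 64 * (1 - Q) := by
      rw [div_mul_eq_mul_div, div_lt_iff₀ hrp]; nlinarith
    have : min (8 / (r + 1)) (1 / 2 : ℝ) * (Q * r + 1) * (Q + r) ≤ 8 / (r + 1) * ((Q * r + 1) * (Q + r)) := by
      rw [mul_assoc]; exact mul_le_mul_of_nonneg_right hm hX
    linarith

/-- ★ THE DATUM-SIDE LIMIT DICHOTOMY HOLDS (C3 RESULT-8/10): `∀ Q ∈ [0,1], ∀ r ≥ 1, A(Q,r) ≥ 0 ∨ T(Q,r) > 0`. -/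
theorem limitDichotomySig_holds : LimitDichotomySig := by
  intro Q r hQ0 hQ1 hr
  by_cases hband : (27 / 256 : ℝ) * (r ^ 2 + 1 + 2 * Q * r) < 2 * (1 - Q) * r
  · exact Or.inr (limT_pos_of_band Q r hQ0 hQ1 hr hband)
  · exact Or.inl (limA_nonneg_of_not_band Q r hQ0 hr (not_lt.mp hband))

end Proof

end RhW08.LimitMenu
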